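import Mathlib.GroupTheory.SpecificGroups.Dihedral
import Mathlib.GroupTheory.OrderOfElement
import Mathlib.Algebra.Group.TypeTags.Basic
import Mathlib.Algebra.Group.Int.Units
import Mathlib.Data.ZMod.Basic
import HarnessLib

/-!
# Automorphisms of `ℤ`, `ℤ/l × ℤ`, `D_∞` and `ℤ/l × D_∞` (`l` odd) — the abstract shapes of the dotted members
# `Π^tp_{Ẋ̲̲}`, `Π^tp_{Ẋ̲}`, `Π^tp_{Ċ̲̲}`, `Π^tp_{Ċ̲}` of the monodromy model of [EtTh] §2

S. Mochizuki, *The étale theta function and its Frobenioid-theoretic manifestations* [EtTh], Publ. RIMS **45**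
(2009), §2 Prop. 2.6 and Rmk. 2.6.1 (PDF p. 40): «`Aut_K(Ċ̲̲) ≅ μ_l × {±1}`, `Aut_K(Ċ̲) ≅ {±1}`, …»
[cite: MochizukiEtTh2009, Rmk 2.6.1 p.40].  Cell abc-iut, layer L2, seat abc-iut-w6-d084 (gen 7), «P26-NV MONODROMY TOY»
STAGE 2 (abc-iut-L2-lead R1352), PROOF-ONLY group theory (no definition, no named fact, nothing of [EtTh] asserted):
the automorphism CENSUS of the four abstract groups which the dotted members of the monodromy model
(`ThetaCoversMonodromyModelAut.lean`) are isomorphic to.  Writing `D_∞ = ⟨r, s⟩` for Mathlib's `DihedralGroup 0`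
(index type `ZMod 0 = ℤ`):
* `mulEquiv_dihedralZero_census`: every automorphism of `D_∞` is `r^i ↦ r^{m i}`, `s r^i ↦ s r^{m i + k}` with `m = ±1`;
* `mulEquiv_int_census`: every automorphism of `ℤ` is `± 1`;
* `mulEquiv_zmodProdInt_census`: every automorphism of `ℤ/l × ℤ` is `(c, n) ↦ (u c + k n, m n)`, `u` a unit, `m = ±1`;
* `mulEquiv_zmodProdDihedral_census` (`l` odd): every automorphism of `ℤ/l × D_∞` is `(c, d) ↦ (u c, ψ_{m,k} d)` — the
  would-be cross term `D_∞ → ℤ/l` vanishes because `D_∞` is generated by involutions and `l` is odd.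
[folklore]
-/

namespace Literature.AnabelianGeometry.EtaleTheta.ThetaCovers.MonodromyModel

open Multiplicative DihedralGroup

/-! ## 1. The infinite dihedral group `D_∞ = DihedralGroup 0` -/

/-- `r^i = 1 ↔ i = 0` in `D_∞`.
(toy bookkeeping for the shapes of [EtTh] Rmk. 2.6.1; classical group theory, no claim about print)
[cite: MochizukiEtTh2009, Rmk 2.6.1 p.40] -/
theorem r_eq_one_iff_zero (i : ZMod 0) : (r i : DihedralGroup 0) = 1 ↔ i = 0 := by
  rw [one_def]
  exact ⟨fun h => by injection h, fun h => by rw [h]⟩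

/-- A rotation of `D_∞` squaring to `1` is trivial (`ℤ` is torsion-free).
(toy bookkeeping for the shapes of [EtTh] Rmk. 2.6.1; classical group theory, no claim about print)
[cite: MochizukiEtTh2009, Rmk 2.6.1 p.40] -/
theorem r_eq_one_of_sq (i : ZMod 0) (h : (r i : DihedralGroup 0) * r i = 1) : (r i : DihedralGroup 0) = 1 := by
  rw [r_mul_r, r_eq_one_iff_zero] at h
  rw [r_eq_one_iff_zero]
  change (show ℤ from i) + (show ℤ from i) = 0 at h
  change (show ℤ from i) = 0
  omega

/-- An element of `D_∞` of order `2` (squares to `1`, is not `1`) is a reflection.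
(toy bookkeeping for the shapes of [EtTh] Rmk. 2.6.1; classical group theory, no claim about print)
[cite: MochizukiEtTh2009, Rmk 2.6.1 p.40] -/
theorem exists_eq_sr_of_sq_eq_one {g : DihedralGroup 0} (h1 : g * g = 1) (h2 : g ≠ 1) : ∃ k, g = sr k := by
  rcases g with j | j
  · exact absurd (r_eq_one_of_sq j h1) h2
  · exact ⟨j, rfl⟩

/-- A unit of `ℤ = ZMod 0` is `±1`.
(toy bookkeeping for the shapes of [EtTh] Rmk. 2.6.1; classical group theory, no claim about print)
[cite: MochizukiEtTh2009, Rmk 2.6.1 p.40] -/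
theorem eq_one_or_neg_one_of_mul_eq_one {m m' : ZMod 0} (h : m * m' = 1) : m = 1 ∨ m = -1 :=
  Int.isUnit_iff.mp (IsUnit.of_mul_eq_one (M := ℤ) m' h)

/-- `(r 1)^i = r^i` in `D_∞` for `i : ZMod 0 = ℤ`.
(toy bookkeeping for the shapes of [EtTh] Rmk. 2.6.1; classical group theory, no claim about print)
[cite: MochizukiEtTh2009, Rmk 2.6.1 p.40] -/
theorem r_one_zpow_zmodZero (i : ZMod 0) : (r 1 : DihedralGroup 0) ^ (show ℤ from i) = r i := by
  rw [r_one_zpow]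
  rfl

/-- `2 i ≠ 1` in `ℤ = ZMod 0`.
(toy bookkeeping for the shapes of [EtTh] Rmk. 2.6.1; classical group theory, no claim about print)
[cite: MochizukiEtTh2009, Rmk 2.6.1 p.40] -/
theorem one_add_one_ne_zero_zmodZero : (1 + 1 : ZMod 0) ≠ 0 := by
  change (1 + 1 : ℤ) ≠ 0
  omega

/-- The centre of `D_∞` is trivial: an element commuting with `r` and with `s` is `1`.
(toy bookkeeping for the shapes of [EtTh] Rmk. 2.6.1; classical group theory, no claim about print)
[cite: MochizukiEtTh2009, Rmk 2.6.1 p.40] -/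
theorem eq_one_of_commute_r_sr {d : DihedralGroup 0} (h1 : d * r 1 = r 1 * d) (h2 : d * sr 0 = sr 0 * d) : d = 1 := by
  rcases d with j | j
  · rw [r_mul_sr, sr_mul_r] at h2
    have h3 : (0 - j : ZMod 0) = 0 + j := by injection h2
    rw [r_eq_one_iff_zero]
    change (0 : ℤ) - (show ℤ from j) = 0 + (show ℤ from j) at h3
    change (show ℤ from j) = 0
    omega
  · rw [sr_mul_r, r_mul_sr] at h1
    have h3 : (j + 1 : ZMod 0) = j - 1 := by injection h1
    change (show ℤ from j) + 1 = (show ℤ from j) - 1 at h3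
    omega

/-- **Automorphism census of `D_∞`**: `φ(r^i) = r^{m i}`, `φ(s r^i) = s r^{m i + k}` with `m = ±1` (so `φ` is the
composite of the conjugation by `s` if `m = −1` and the shift `s r^i ↦ s r^{i+k}`).
(toy bookkeeping for the shapes of [EtTh] Rmk. 2.6.1; classical group theory, no claim about print)
[cite: MochizukiEtTh2009, Rmk 2.6.1 p.40] -/
theorem mulEquiv_dihedralZero_census (φ : DihedralGroup 0 ≃* DihedralGroup 0) :
    ∃ m k : ZMod 0, (m = 1 ∨ m = -1) ∧ (∀ i, φ (r i) = r (m * i)) ∧ ∀ i, φ (sr i) = sr (m * i + k) := by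
  -- `φ(r 1)` (and `φ⁻¹(r 1)`) is a rotation: it does not square to `1`
  have hrot : ∀ ψ : DihedralGroup 0 ≃* DihedralGroup 0, ∃ m, ψ (r 1) = r m := fun ψ => by
    rcases h : ψ (r 1) with j | j
    · exact ⟨j, rfl⟩
    · exfalso
      have h2 : ψ (r 1 * r 1) = 1 := by rw [map_mul, h, sr_mul_self]
      rw [map_eq_one_iff _ ψ.injective, r_mul_r, r_eq_one_iff_zero] at h2
      exact one_add_one_ne_zero_zmodZero h2
  obtain ⟨m, hm⟩ := hrot φ
  obtain ⟨m', hm'⟩ := hrot φ.symm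
  have hri : ∀ i, φ (r i) = r (m * i) := fun i => by
    rw [← r_one_zpow_zmodZero i, map_zpow, hm, r_zpow]
    rfl
  have hunit : m = 1 ∨ m = -1 := by
    have h1 : φ (φ.symm (r 1)) = r 1 := φ.apply_symm_apply _
    rw [hm', hri] at h1
    have h2 : m * m' = 1 := by injection h1
    exact eq_one_or_neg_one_of_mul_eq_one h2
  -- `φ(s)` is a reflection `s r^k`
  obtain ⟨k, hk⟩ : ∃ k, φ (sr 0) = sr k :=
    exists_eq_sr_of_sq_eq_one (by rw [← map_mul, sr_mul_self, map_one])
      (by rw [Ne, map_eq_one_iff _ φ.injective, one_def]; exact fun h => by cases h)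
  refine ⟨m, k, hunit, hri, fun i => ?_⟩
  rw [show sr i = sr 0 * r i by rw [sr_mul_r, zero_add], map_mul, hk, hri, sr_mul_r, add_comm]

/-! ## 2. `ℤ` and `ℤ/l × ℤ` -/

/-- `n = 1^n` in `Multiplicative ℤ`.
(toy bookkeeping for the shapes of [EtTh] Rmk. 2.6.1; classical group theory, no claim about print)
[cite: MochizukiEtTh2009, Rmk 2.6.1 p.40] -/
theorem eq_ofAdd_one_zpow (n : Multiplicative ℤ) : n = ofAdd (1 : ℤ) ^ toAdd n := by
  apply toAdd.injective
  rw [toAdd_zpow, toAdd_ofAdd, smul_eq_mul, mul_one]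

/-- **Automorphism census of `ℤ`**: `±1`.
(toy bookkeeping for the shapes of [EtTh] Rmk. 2.6.1; classical group theory, no claim about print)
[cite: MochizukiEtTh2009, Rmk 2.6.1 p.40] -/
theorem mulEquiv_int_census (φ : Multiplicative ℤ ≃* Multiplicative ℤ) :
    ∃ m : ℤ, (m = 1 ∨ m = -1) ∧ ∀ n, φ n = ofAdd (m * toAdd n) := by
  have hφ : ∀ n, φ n = ofAdd (toAdd (φ (ofAdd 1)) * toAdd n) := fun n => by
    conv_lhs => rw [eq_ofAdd_one_zpow n, map_zpow]
    apply toAdd.injective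
    rw [toAdd_zpow, toAdd_ofAdd, smul_eq_mul, mul_comm]
  refine ⟨toAdd (φ (ofAdd 1)), ?_, hφ⟩
  obtain ⟨x, hx⟩ := φ.surjective (ofAdd 1)
  rw [hφ] at hx
  have h2 : toAdd (φ (ofAdd 1)) * toAdd x = 1 := by simpa using congrArg toAdd hx
  exact Int.isUnit_iff.mp (IsUnit.of_mul_eq_one _ h2)

variable (l : ℕ)

/-- An additive endomorphism of `ℤ/l` is multiplication by the image of `1`.
(toy bookkeeping for the shapes of [EtTh] Rmk. 2.6.1; classical group theory, no claim about print)
[cite: MochizukiEtTh2009, Rmk 2.6.1 p.40] -/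
theorem addMonoidHom_zmod_apply (α : ZMod l →+ ZMod l) (c : ZMod l) : α c = α 1 * c := by
  have hc : c = (c.cast : ℤ) • (1 : ZMod l) := by
    rw [zsmul_eq_mul, mul_one, ZMod.intCast_zmod_cast]
  conv_lhs => rw [hc, map_zsmul]
  rw [zsmul_eq_mul, mul_comm, ZMod.intCast_zmod_cast]

/-- The elements of finite order of `ℤ/l × ℤ` (`l ≠ 0`) are those with trivial `ℤ`-component.
(toy bookkeeping for the shapes of [EtTh] Rmk. 2.6.1; classical group theory, no claim about print)
[cite: MochizukiEtTh2009, Rmk 2.6.1 p.40] -/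
theorem isOfFinOrder_zmodProdInt_iff [NeZero l] (x : Multiplicative (ZMod l × ℤ)) :
    IsOfFinOrder x ↔ (toAdd x).2 = 0 := by
  constructor
  · intro h
    obtain ⟨n, hn, hx⟩ := h.exists_pow_eq_one
    have h2 := congrArg (fun y => (toAdd y).2) hx
    rw [toAdd_pow, toAdd_one, Prod.smul_snd, Prod.snd_zero, nsmul_eq_mul] at h2
    rcases mul_eq_zero.mp h2 with h3 | h3
    · exact absurd h3 (by exact_mod_cast hn.ne')
    · exact h3
  · intro h
    refine isOfFinOrder_iff_pow_eq_one.mpr ⟨l, Nat.pos_of_ne_zero (NeZero.ne l), ?_⟩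
    apply toAdd.injective
    rw [toAdd_pow, toAdd_one, Prod.ext_iff, Prod.smul_fst, Prod.smul_snd, h, smul_zero, nsmul_eq_mul,
      ZMod.natCast_self, zero_mul]
    exact ⟨rfl, rfl⟩

/-- A pair of `ℤ/l × ℤ` as `(c, 0) · (0, 1)^n`.
(toy bookkeeping for the shapes of [EtTh] Rmk. 2.6.1; classical group theory, no claim about print)
[cite: MochizukiEtTh2009, Rmk 2.6.1 p.40] -/
theorem ofAdd_pair_eq (c : ZMod l) (n : ℤ) :
    (ofAdd (c, n) : Multiplicative (ZMod l × ℤ)) = ofAdd (c, (0 : ℤ)) * ofAdd ((0 : ZMod l), (1 : ℤ)) ^ n := by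
  apply toAdd.injective
  rw [toAdd_mul, toAdd_zpow, toAdd_ofAdd, toAdd_ofAdd, toAdd_ofAdd, Prod.ext_iff, Prod.fst_add, Prod.snd_add,
    Prod.smul_fst, Prod.smul_snd, smul_zero, add_zero, smul_eq_mul, mul_one, zero_add]
  exact ⟨rfl, rfl⟩

/-- **Automorphism census of `ℤ/l × ℤ`** (`l ≠ 0`): `φ(c, n) = (u c + k n, m n)` with `u` a unit and `m = ±1`
(the torsion subgroup `ℤ/l × 0` is characteristic).
(toy bookkeeping for the shapes of [EtTh] Rmk. 2.6.1; classical group theory, no claim about print)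
[cite: MochizukiEtTh2009, Rmk 2.6.1 p.40] -/
theorem mulEquiv_zmodProdInt_census [NeZero l] (φ : Multiplicative (ZMod l × ℤ) ≃* Multiplicative (ZMod l × ℤ)) :
    ∃ (u k : ZMod l) (m : ℤ), IsUnit u ∧ (m = 1 ∨ m = -1) ∧
      ∀ c n, φ (ofAdd (c, n)) = ofAdd (u * c + k * n, m * n) := by
  have hinj : Function.Injective (φ : Multiplicative (ZMod l × ℤ) →* Multiplicative (ZMod l × ℤ)) := φ.injective
  -- the torsion part: `φ(c, 0) = (α c, 0)` with `α` additive, `α c = u c`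
  have htor : ∀ c : ZMod l, (toAdd (φ (ofAdd (c, 0)))).2 = 0 := fun c =>
    (isOfFinOrder_zmodProdInt_iff l _).mp
      ((hinj.isOfFinOrder_iff).mpr ((isOfFinOrder_zmodProdInt_iff l _).mpr rfl))
  let α : ZMod l →+ ZMod l :=
    { toFun := fun c => (toAdd (φ (ofAdd (c, 0)))).1
      map_zero' := by rw [Prod.mk_zero_zero, ofAdd_zero, map_one, toAdd_one, Prod.fst_zero]
      map_add' := fun c c' => by
        rw [show ((c + c', 0) : ZMod l × ℤ) = (c, 0) + (c', 0) by rw [Prod.mk_add_mk, add_zero], ofAdd_add,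
          map_mul, toAdd_mul, Prod.fst_add] }
  have hα : ∀ c, φ (ofAdd (c, 0)) = ofAdd (α 1 * c, 0) := fun c => by
    apply toAdd.injective
    rw [toAdd_ofAdd, Prod.ext_iff]
    exact ⟨addMonoidHom_zmod_apply l α c, htor c⟩
  -- `φ(0, 1) = (k, m)` and the general formula
  have hgen : ∀ c n, φ (ofAdd (c, n)) =
      ofAdd (α 1 * c + (toAdd (φ (ofAdd (0, 1)))).1 * n, (toAdd (φ (ofAdd (0, 1)))).2 * n) := fun c n => by
    rw [ofAdd_pair_eq, map_mul, map_zpow, hα]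
    apply toAdd.injective
    rw [toAdd_mul, toAdd_zpow, toAdd_ofAdd, toAdd_ofAdd, Prod.ext_iff, Prod.fst_add, Prod.snd_add, Prod.smul_fst,
      Prod.smul_snd, zsmul_eq_mul, smul_eq_mul, zero_add, mul_comm ((n : ℤ) : ZMod l), mul_comm n]
    exact ⟨rfl, rfl⟩
  refine ⟨α 1, (toAdd (φ (ofAdd (0, 1)))).1, (toAdd (φ (ofAdd (0, 1)))).2, ?_, ?_, hgen⟩
  · -- `u` is a unit: `φ⁻¹(1, 0)` is torsion, `= (c, 0)`, and `u c = 1`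
    obtain ⟨x, hx⟩ := φ.surjective (ofAdd (1, 0))
    have hx2 : (toAdd x).2 = 0 := (isOfFinOrder_zmodProdInt_iff l _).mp
      ((hinj.isOfFinOrder_iff).mp (by
        change IsOfFinOrder (φ x); rw [hx]; exact (isOfFinOrder_zmodProdInt_iff l _).mpr rfl))
    have hx' : x = ofAdd ((toAdd x).1, (0 : ℤ)) := by
      apply toAdd.injective; rw [toAdd_ofAdd, Prod.ext_iff]; exact ⟨rfl, hx2⟩
    rw [hx', hgen] at hx
    have h1 := congrArg (fun y => (toAdd y).1) hx
    simp only [toAdd_ofAdd, Int.cast_zero, mul_zero, add_zero] at h1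
    exact IsUnit.of_mul_eq_one _ h1
  · -- `m = ±1`: `φ⁻¹(0, 1) = (c, n)` gives `m n = 1`
    obtain ⟨x, hx⟩ := φ.surjective (ofAdd (0, 1))
    have hx' : x = ofAdd ((toAdd x).1, (toAdd x).2) := by
      apply toAdd.injective; rw [toAdd_ofAdd]
    rw [hx', hgen] at hx
    have h1 := congrArg (fun y => (toAdd y).2) hx
    simp only [toAdd_ofAdd] at h1
    exact Int.isUnit_iff.mp (IsUnit.of_mul_eq_one _ h1)

/-! ## 3. `ℤ/l × D_∞`, `l` odd -/

/-- **Automorphism census of `ℤ/l × D_∞`** (`l` odd): `φ(c, r^i) = (u c, r^{m i})`, `φ(c, s r^i) = (u c, s r^{m i + k})` with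
`u` a unit and `m = ±1`: the centre `ℤ/l × 1` is characteristic, the involutions `(1, s r^i)` go to involutions, whose
`ℤ/l`-component is `2`-torsion hence trivial (`l` odd), and `r = s · s r`.
(toy bookkeeping for the shapes of [EtTh] Rmk. 2.6.1; classical group theory, no claim about print)
[cite: MochizukiEtTh2009, Rmk 2.6.1 p.40] -/
theorem mulEquiv_zmodProdDihedral_census (hl : Odd l)
    (φ : (Multiplicative (ZMod l) × DihedralGroup 0) ≃* (Multiplicative (ZMod l) × DihedralGroup 0)) :
    ∃ (u : ZMod l) (m k : ZMod 0), IsUnit u ∧ (m = 1 ∨ m = -1) ∧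
      (∀ c i, φ (c, r i) = (ofAdd (u * toAdd c), r (m * i))) ∧
      ∀ c i, φ (c, sr i) = (ofAdd (u * toAdd c), sr (m * i + k)) := by
  -- in `ℤ/l`, `l` odd, `y + y = 0 ⇒ y = 0` (cf. `SignToy.eq_zero_of_add_self`, not imported to keep this file light)
  have h2tors : ∀ {y : ZMod l}, y + y = 0 → y = 0 := fun {y} h => by
    have h2 : (2 : ZMod l) * y = 0 := by rw [two_mul, h]
    have hu : IsUnit (2 : ZMod l) := by
      have := (ZMod.unitOfCoprime 2 (Nat.coprime_two_left.mpr hl)).isUnit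
      simpa using this
    exact (hu.mul_right_eq_zero).mp h2
  -- (a) the centre `{(c, 1)}` is characteristic
  have hcentral : ∀ c : Multiplicative (ZMod l), (φ (c, 1)).2 = 1 := fun c => by
    have hz : ∀ y : Multiplicative (ZMod l) × DihedralGroup 0, (c, (1 : DihedralGroup 0)) * y = y * (c, 1) :=
      fun y => Prod.ext (mul_comm c y.1) (by rw [Prod.snd_mul, Prod.snd_mul, one_mul, mul_one])
    refine eq_one_of_commute_r_sr ?_ ?_
    · have := congrArg Prod.snd (congrArg φ (hz (φ.symm (1, r 1))))
      simpa [map_mul] using this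
    · have := congrArg Prod.snd (congrArg φ (hz (φ.symm (1, sr 0))))
      simpa [map_mul] using this
  let α : ZMod l →+ ZMod l :=
    { toFun := fun c => toAdd (φ (ofAdd c, 1)).1
      map_zero' := by rw [ofAdd_zero, Prod.mk_one_one, map_one, Prod.fst_one, toAdd_one]
      map_add' := fun c c' => by
        rw [ofAdd_add, show ((ofAdd c * ofAdd c', (1 : DihedralGroup 0)) : Multiplicative (ZMod l) × DihedralGroup 0) =
          (ofAdd c, 1) * (ofAdd c', 1) by rw [Prod.mk_mul_mk, mul_one], map_mul, Prod.fst_mul, toAdd_mul] }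
  have hα : ∀ c : Multiplicative (ZMod l), φ (c, 1) = (ofAdd (α 1 * toAdd c), 1) := fun c => by
    refine Prod.ext ?_ (hcentral c)
    apply toAdd.injective
    rw [toAdd_ofAdd, ← addMonoidHom_zmod_apply l α (toAdd c)]
    change toAdd (φ (c, 1)).1 = toAdd (φ (ofAdd (toAdd c), 1)).1
    rw [ofAdd_toAdd]
  -- (b) involutions `(1, s r^i)` go to `(1, s r^{k_i})`
  have hinv : ∀ i : ZMod 0, ∃ ki, φ (1, sr i) = (1, sr ki) := fun i => by
    have hsq : φ (1, sr i) * φ (1, sr i) = 1 := by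
      rw [← map_mul, Prod.mk_mul_mk, one_mul, sr_mul_self, Prod.mk_one_one, map_one]
    have hne : φ (1, sr i) ≠ 1 := by
      rw [Ne, map_eq_one_iff _ φ.injective, Prod.mk_eq_one, one_def]
      exact fun h => by cases h.2
    have h1 : (φ (1, sr i)).1 = 1 := by
      have h := congrArg Prod.fst hsq
      rw [Prod.fst_mul, Prod.fst_one] at h
      apply toAdd.injective
      rw [toAdd_one]
      exact h2tors (by rw [← toAdd_mul, h, toAdd_one])
    have h2 : (φ (1, sr i)).2 * (φ (1, sr i)).2 = 1 := by
      have h := congrArg Prod.snd hsq; rwa [Prod.snd_mul, Prod.snd_one] at h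
    have h3 : (φ (1, sr i)).2 ≠ 1 := fun h => hne (Prod.ext h1 h)
    obtain ⟨ki, hki⟩ := exists_eq_sr_of_sq_eq_one h2 h3
    exact ⟨ki, Prod.ext h1 hki⟩
  obtain ⟨k, hk⟩ := hinv 0
  obtain ⟨k₁, hk₁⟩ := hinv 1
  -- (c) `φ(1, r 1) = (1, r m)` with `m = k₁ - k`, hence `φ(1, r i) = (1, r (m i))`
  have hr1 : φ (1, r 1) = (1, r (k₁ - k)) := by
    rw [show ((1 : Multiplicative (ZMod l)), (r 1 : DihedralGroup 0)) = (1, sr 0) * (1, sr 1) by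
      rw [Prod.mk_mul_mk, one_mul, sr_mul_sr, sub_zero], map_mul, hk, hk₁, Prod.mk_mul_mk, one_mul, sr_mul_sr]
  have hri : ∀ i : ZMod 0, φ (1, r i) = (1, r ((k₁ - k) * i)) := fun i => by
    have h1 : ((1 : Multiplicative (ZMod l)), (r i : DihedralGroup 0)) = (1, r 1) ^ (show ℤ from i) := by
      rw [Prod.pow_mk, one_zpow, r_one_zpow_zmodZero]
    rw [h1, map_zpow, hr1, Prod.pow_mk, one_zpow, r_zpow]
    rfl
  have hgen_r : ∀ c i, φ (c, r i) = (ofAdd (α 1 * toAdd c), r ((k₁ - k) * i)) := fun c i => by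
    have e : ((c, r i) : Multiplicative (ZMod l) × DihedralGroup 0) = (c, 1) * (1, r i) :=
      Prod.ext (by simp) (by simp)
    rw [e, map_mul, hα, hri]
    exact Prod.ext (by simp) (by simp)
  have hgen_sr : ∀ c i, φ (c, sr i) = (ofAdd (α 1 * toAdd c), sr ((k₁ - k) * i + k)) := fun c i => by
    have e : ((c, sr i) : Multiplicative (ZMod l) × DihedralGroup 0) = (c, 1) * ((1, sr 0) * (1, r i)) :=
      Prod.ext (by simp) (by simp [sr_mul_r])
    rw [e, map_mul, map_mul, hα, hk, hri]
    exact Prod.ext (by simp) (by simp [sr_mul_r, add_comm])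
  refine ⟨α 1, k₁ - k, k, ?_, ?_, hgen_r, hgen_sr⟩
  · -- `u` is a unit
    obtain ⟨⟨c, d⟩, hx⟩ := φ.surjective (ofAdd 1, 1)
    rcases d with j | j
    · rw [hgen_r] at hx
      have h1 := congrArg (fun y => toAdd y.1) hx
      simp only [toAdd_ofAdd] at h1
      exact IsUnit.of_mul_eq_one _ h1
    · rw [hgen_sr] at hx
      have h1 := congrArg (fun y => toAdd y.1) hx
      simp only [toAdd_ofAdd] at h1
      exact IsUnit.of_mul_eq_one _ h1
  · -- `m = ±1`
    obtain ⟨⟨c, d⟩, hx⟩ := φ.surjective (1, r 1)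
    rcases d with j | j
    · rw [hgen_r] at hx
      have h2 : r ((k₁ - k) * j) = (r 1 : DihedralGroup 0) := (Prod.ext_iff.mp hx).2
      exact eq_one_or_neg_one_of_mul_eq_one (by injection h2)
    · rw [hgen_sr] at hx
      have h2 : sr ((k₁ - k) * j + k) = (r 1 : DihedralGroup 0) := (Prod.ext_iff.mp hx).2
      cases h2

end Literature.AnabelianGeometry.EtaleTheta.ThetaCovers.MonodromyModel
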